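import Mathlib
import Literature.Analysis.FluidPDE.SteadyNSSolution
import HarnessLib

/-!
# The pressure Hessian of a steady `D`-solution on `ℝ³` is integrable (Wang 2025, Lemma 3.5;
after Coifman–Lions–Meyer–Semmes 1993 and Korobkov–Pileckas–Russo 2015)

Topic `Literature/Analysis/FluidPDE`. One NAMED FACT (D-0014; `def … : Prop`, taken by users as a
hypothesis `(h : …)`), requested by director-ns (#208 (1)(b), 2026-08-28) for the «all-axes cylinder
budget» lines of the Liouville items `stmt-NavierStokesRegularity-0895` (`GaldiLiouvilleGate.GaldiLiouville`)
and `…-0896` (axisymmetric variant): there it is obligation O1a `PressureHessianIntegrable`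
(`∀ ν > 0, ∀ U P, IsDSolution-hypotheses → Integrable (iteratedFDeriv ℝ 2 P)`), the input that makes
every cylinder functional `∬_{r = t} |p| dθ dz` finite and tend to `0` (Wang's proof of the
Korobkov–Pileckas–Russo theorem, §3.5.1).

* `wang2025_lem35_DSolution_pressureHessian_integrable` — **Wang 2025, Lemma 3.5** (p. 50 of the
  held text, §3.5.1 «无旋条件下的 Liouville 性质»): "引理 3.5 对于 Euler 系统 (3.24) 和 Navier–Stokes
  系统 (0.1), 可知 `∇²p ∈ L¹(ℝ³)`." — for the Euler system (3.24) and the Navier–Stokes system (0.1)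
  one has `∇²p ∈ L¹(ℝ³)`. Printed proof: "因为 `Δp = −(∇u)(∇u)ᵀ ∈ ℋ¹(ℝ³)`" (the
  Coifman–Lions–Meyer–Semmes div–curl lemma), the Newtonian potential
  `G = (4π)⁻¹ ∫ |x−y|⁻¹ (∇u)(∇u)ᵀ(y) dy` has `∇²G ∈ L¹(ℝ³)` by the Calderón–Zygmund estimate on
  `ℋ¹`, and `Δ(p − G) = 0`, `∇(p − G) ∈ L^{3/2}(ℝ³)` give `p − G = c`.

## Rendering choices (read before use)

* STANDING HYPOTHESES. Lemma 3.5 sits in §3.5.1, whose standing hypotheses are the system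
  ((3.24) resp. (0.1)), the decay `lim_{|x|→∞} u(x) = 0` ((3.25) resp. (0.2)) and the finite
  Dirichlet integral `∫|∇u|² < ∞` ((3.26) resp. (0.3)) — the hypotheses of Theorems 3.5/3.6 printed
  immediately before it (the axisymmetry / `u_θ = 0` of those theorems is not used in the lemma's
  proof). Rendered, as in the sibling fact `wang2025_thm21_DSolution_uniformDecay`
  (`SteadyDSolutionAsymptotics.lean`), for the tree's classical class `IsDSolution 1 0 u p`
  (`SteadyNSSolution.lean`: `u ∈ C²`, `p ∈ C¹`, the pointwise system (0.1) with `ν = 1`, `f = 0`,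
  `∫⁻ ofReal |∇u|² < ∞` = (0.3)) together with the decay (0.2) `Tendsto u (cocompact ℝ³) (𝓝 0)`
  stated explicitly (under (0.2)+(0.3), `u ∈ Ḣ¹ ⊂ L⁶`, Galdi 2011 Thm II.6.1 / Wang Thm 1.5, which is
  the class in which the printed `∇(p − G) ∈ L^{3/2}` step runs; without (0.2) constant flows with
  an affine pressure shift are not excluded by (0.1)+(0.3) alone only because the pressure of a
  constant flow is constant — we keep the printed hypothesis rather than argue the edge case).
* `∇²p ∈ L¹(ℝ³)` is rendered with Mathlib's `iteratedFDeriv ℝ 2 p` (a continuous-bilinear-map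
  valued function whose operator norm is comparable, up to absolute constants, with
  `maxᵢⱼ |∂ᵢ∂ⱼ p|`): `Integrable (iteratedFDeriv ℝ 2 p) volume` — literally the shape of the
  consumer obligation O1a. `D`-solutions are `C^∞` (Galdi 2011, Thm X.1.1; Wang p. 28), so no junk
  values of `iteratedFDeriv` of a non-`C²` function are being asserted in the intended use; a user
  holding only `p ∈ C¹` reads the statement about Mathlib's `iteratedFDeriv` as defined.
* Viscosity `ν = 1` as printed ((0.1)); for `ν > 0` apply the fact to `(ν⁻¹u, ν⁻²p)` — done below in
  `wang2025_lem35_DSolution_pressureHessian_integrable.of_viscosity` (PROVED here, for `p ∈ C²`).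
* Only the Navier–Stokes half of the lemma is typed.
  -- TODO(general form): the Euler half (system (3.24) under (3.25)–(3.26)), same conclusion.

## References

* W. Wang (王文栋), *稳态Navier–Stokes方程的Liouville定理* (Liouville theorems for the steady
  Navier–Stokes equations), Science Press, Beijing (2025): Lemma 3.5, §3.5.1 (held:
  `book:anonnd-navier-stokesliouville`, chunk p0050; (0.1)–(0.3) p. 1; Thms 3.5/3.6 and
  (3.24)–(3.26), chunk p0049). [Wang2025]
* M. Korobkov, K. Pileckas, R. Russo, *The Liouville theorem for the steady-state Navier–Stokes
  problem for axially symmetric 3D solutions in absence of swirl*, J. Math. Fluid Mech. 17 (2015)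
  287–293 (Wang's [58]; the lemma is theirs). [KorobkovPileckasRusso2015]
* R. Coifman, P.-L. Lions, Y. Meyer, S. Semmes, *Compensated compactness and Hardy spaces*,
  J. Math. Pures Appl. 72 (1993) 247–286 (the `ℋ¹` div–curl lemma used in the proof; cited
  through Wang).
-/

noncomputable section

namespace Literature.Analysis.FluidPDE

open _root_.MeasureTheory _root_.Filter _root_.Set
open scoped ENNReal Topology

/-- **Wang 2025, Lemma 3.5 (Korobkov–Pileckas–Russo 2015; CLMS 1993): the pressure Hessian of a
`D`-solution is integrable.** "对于 … Navier–Stokes 系统 (0.1), 可知 `∇²p ∈ L¹(ℝ³)`" — for the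
Navier–Stokes system (0.1) [`−Δu + u·∇u = −∇p`, `∇·u = 0` on `ℝ³`], under the standing hypotheses
of §3.5.1, (0.2) `u(x) → 0` as `|x| → ∞` and (0.3) `∫|∇u|² < ∞`, one has `∇²p ∈ L¹(ℝ³)`
(`Δp = −(∇u)(∇u)ᵀ ∈ ℋ¹`, Calderón–Zygmund on `ℋ¹`, Liouville for `p − G`). Rendered for the
tree's classical `D`-solutions `IsDSolution 1 0 u p` with the decay hypothesis explicit and
`∇²p ∈ L¹` as `Integrable (iteratedFDeriv ℝ 2 p)`; viscosity `1` as printed (general `ν > 0`: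
`.of_viscosity`). Input O1a of the «cylinder budget» lines of `GaldiLiouvilleGate.GaldiLiouville`
(stmt-NavierStokesRegularity-0895 and -0896). [cite: Wang2025, Lemma 3.5] -/
def wang2025_lem35_DSolution_pressureHessian_integrable : Prop :=
  ∀ (u : EuclideanSpace ℝ (Fin 3) → EuclideanSpace ℝ (Fin 3)) (p : EuclideanSpace ℝ (Fin 3) → ℝ),
    IsDSolution 1 0 u p → Tendsto u (cocompact (EuclideanSpace ℝ (Fin 3))) (𝓝 0) →
    Integrable (iteratedFDeriv ℝ 2 p) volume

/-- **Lemma 3.5 for every viscosity `ν > 0`** (PROVED from the `ν = 1` fact by the viscosity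
normalisation `(u, p) ↦ (ν⁻¹u, ν⁻²p)`, `IsSteadyNSSolution.viscosity_one`): a `D`-solution of the
`ν`-system with `u → 0` at infinity and `p ∈ C²` has `∇²p ∈ L¹(ℝ³)`
(`∇²(ν⁻²p) = ν⁻² ∇²p`, `∫|∇(ν⁻¹u)|² = ν⁻² ∫|∇u|²`). [cite: Wang2025, Lemma 3.5] -/
theorem wang2025_lem35_DSolution_pressureHessian_integrable.of_viscosity
    (h : wang2025_lem35_DSolution_pressureHessian_integrable) {ν : ℝ} (hν : 0 < ν)
    {u : EuclideanSpace ℝ (Fin 3) → EuclideanSpace ℝ (Fin 3)} {p : EuclideanSpace ℝ (Fin 3) → ℝ}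
    (hu : IsDSolution ν 0 u p) (hp : ContDiff ℝ 2 p)
    (hdec : Tendsto u (cocompact (EuclideanSpace ℝ (Fin 3))) (𝓝 0)) :
    Integrable (iteratedFDeriv ℝ 2 p) volume := by
  have hν0 : ν ≠ 0 := hν.ne'
  -- the normalised pair `(ν⁻¹u, ν⁻²p)` solves the `ν = 1` system
  have h1 : IsSteadyNSSolution 1 0 (ν⁻¹ • u) (ν⁻¹ ^ 2 • p) := by
    simpa using hu.isSteadyNSSolution.viscosity_one hν0
  -- its Dirichlet integral is `ν⁻² ∫|∇u|² < ∞`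
  have hud : Differentiable ℝ u := hu.isSteadyNSSolution.contDiff_velocity.differentiable (by norm_num)
  have hfrob : ∀ y, frobeniusNormSq (fderiv ℝ (ν⁻¹ • u) y) = (ν⁻¹) ^ 2 * frobeniusNormSq (fderiv ℝ u y) := by
    intro y
    rw [fderiv_const_smul (hud y) ν⁻¹]
    unfold frobeniusNormSq
    rw [Finset.mul_sum]
    refine Finset.sum_congr rfl fun i _ => ?_
    rw [_root_.smul_apply, norm_smul, mul_pow, Real.norm_eq_abs, sq_abs]
  have hD : (∫⁻ y, ENNReal.ofReal (frobeniusNormSq (fderiv ℝ (ν⁻¹ • u) y))) < ∞ := by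
    have e : (fun y => ENNReal.ofReal (frobeniusNormSq (fderiv ℝ (ν⁻¹ • u) y))) =
        fun y => ENNReal.ofReal ((ν⁻¹) ^ 2) * ENNReal.ofReal (frobeniusNormSq (fderiv ℝ u y)) := by
      funext y; rw [hfrob y, ENNReal.ofReal_mul (sq_nonneg _)]
    rw [e, lintegral_const_mul' _ _ ENNReal.ofReal_ne_top]
    exact ENNReal.mul_lt_top ENNReal.ofReal_lt_top hu.dirichlet_lt_top
  have hD1 : IsDSolution 1 0 (ν⁻¹ • u) (ν⁻¹ ^ 2 • p) := ⟨h1, hD⟩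
  -- decay is preserved
  have hdec1 : Tendsto (ν⁻¹ • u) (cocompact (EuclideanSpace ℝ (Fin 3))) (𝓝 0) := by
    have h := hdec.const_smul ν⁻¹
    rw [smul_zero] at h
    exact h
  -- apply the fact and undo the scaling of the Hessian
  have hint := h _ _ hD1 hdec1
  have e2 : iteratedFDeriv ℝ 2 (ν⁻¹ ^ 2 • p) = ν⁻¹ ^ 2 • iteratedFDeriv ℝ 2 p := by
    funext x
    exact iteratedFDeriv_const_smul_apply (hp.of_le le_rfl).contDiffAt
  rw [e2] at hint
  exact (integrable_smul_iff (pow_ne_zero 2 (inv_ne_zero hν0)) _).1 hint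

end Literature.Analysis.FluidPDE

end
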